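import Mathlib
import Summits.MatrixMultiplication.MatrixMultiplication.Theses.OctonionicLaser
import Summits.MatrixMultiplication.MatrixMultiplication.Theorems.OctonionicLaserDefs
import Summits.MatrixMultiplication.MatrixMultiplication.Theorems.OctonionicLaserOctKoszulFourteen
import Summits.MatrixMultiplication.MatrixMultiplication.Theorems.OctonionicLaserOctAsymptoticRankStubOctonionBasis
import Summits.MatrixMultiplication.MatrixMultiplication.Theorems.OctonionicLaserOctAsymptoticRankMilestonesIff
import Literature.Computability.AlgebraicComplexity.AsymptoticRankMultiplesMatMul
import Literature.Computability.AlgebraicComplexity.BigCwFourthOmega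
import Literature.Barriers.MatrixMultiplication.UniversalMethodBarrierAsymptoticRank

/-!
# `OctAsymptoticRank` (stmt-MatrixMultiplication-7930), line `registered` — the four-block bound
# `R̃(t₈) ≤ 4 · 2^ω < 20.75`

Route `OctonionicLaser`, crux `OctAsymptoticRank : R̃(t₈) ≤ 8` (`t₈ = octT ℂ`, the complex octonions as
the Cayley–Dickson double of `M₂(ℂ)`, `(a,b)(c,d) = (ac − adj(d) b, da + b·adj(c))`).  The registered
stub `stub_powerMilestones` (border-rank power milestones at rate `8`) is equivalent to the crux
(`octAsymptoticRank_iff_signedTable_milestones`).  This support file records the best UNCONDITIONAL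
rate at which the milestones are now known to hold, and the mechanism behind it:

* `fourBlocks_restrictsTo_octT` — `t₈` is a RESTRICTION of four independent `2 × 2` matrix products,
  `⟨4⟩ ⊗ ⟨2,2,2⟩ ≥ t₈`: the four graded blocks `ac`, `−adj(d)b`, `da`, `b·adj(c)` of the Cayley–Dickson
  product are `GL`-copies of `⟨2,2,2⟩` (transposition `(xy)ᵀ = yᵀxᵀ` puts the first factor on the left,
  the adjugate `adj(E_{kl}) = (−1)^{k+l}E_{l̄ k̄}` is a signed permutation of matrix units), glued
  additively along the `ℤ/2`-grading by non-injective restriction maps with entries in `{0, ±1}`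
  (kernel certificate `key4x8`, `512` integer identities of `32` terms).
* `asymptoticRank_octT_le_four_mul_two_rpow_omega` — hence **`R̃(t₈) ≤ R̃(⟨4⟩ ⊗ ⟨2,2,2⟩) = 4 · 2^ω`**
  (monotonicity of `R̃` under restriction ⊂ degeneration, `asymptoticRank_le_of_polyDegeneratesTo`;
  `R̃(⟨t⟩ ⊗ ⟨q,q,q⟩) = t·q^ω`, `asymptoticRank_multiple_matMulTensor_cube`).
* `asymptoticRank_octT_lt` — with the tree's proved `ω ≤ 2.37295` (`LeGall2014_cw4_omega_le`, the
  fourth power of the Coppersmith–Winograd tensor) and `2^{19/8} < 83/16`: **`R̃(t₈) < 83/4 = 20.75`**,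
  against the previous best `R̃(t₈) ≤ R(t₈) ≤ 26` (`tensorRank_octT_leTwentySix`); `ω = 2` would give
  `R̃(t₈) ≤ 16`, so restriction from FOUR blocks can never reach the crux value `8` — three blocks
  (`t₈ ⊴ ⟨3⟩ ⊗ ⟨2,2,2⟩`, or `t₈ ⊴ ⟨3,3,3⟩`) is the first degeneration question whose answer is open.
* `signedTable_milestones_rate` — in the stub's own currency: for every `δ > 0` some Kronecker power of
  the signed `𝔽₂³` table `𝕊` has `bR(𝕊^{⊠k}) ≤ ((83/4)(1+δ))^k` (`milestones_of_asymptoticRank_le` and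
  the landed transfer `𝕊 ≥ t₈ ≥ 𝕊`); the stub asks for rate `8`.

Sources: R. D. Schafer, *An introduction to nonassociative algebras* (1966), Ch. III §4
(Cayley–Dickson doubling); M. Bläser, *Fast Matrix Multiplication* (2013), §5 (`⟨k,m,n⟩`), §7
(direct sums, `⟨t⟩ ⊗ ·`) [Blaser2013]; M. Christandl, P. Vrana, J. Zuiddam, J. AMS 36 (2023) §1.1
[ChristandlVranaZuiddam2023]; F. Le Gall, ISSAC 2014, Table 2 [LeGall2014].  No fact is cited as a
hypothesis; the file declares no definition.
-/

-- single-conjunct summit: the mandated namespace repeats MatrixMultiplication.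
set_option linter.dupNamespace false

noncomputable section

namespace Summit.MatrixMultiplication.MatrixMultiplication.Theorems

namespace OctAsymptoticRank

open Literature.Computability.AlgebraicComplexity
open Literature.Barriers.MatrixMultiplication (asymptoticRank_le_of_polyDegeneratesTo)
open Summit.MatrixMultiplication.MatrixMultiplication.Theorems.OctonionicLaser
  (octT octEnc octTab octT_int_eq_octTab)
open Summit.MatrixMultiplication.MatrixMultiplication.Theses.OctonionicLaser (OctAsymptoticRank)

/-! ## The restriction maps (local notations; no definitions are declared)

Block `j : Fin 4` of `⟨4⟩ ⊗ ⟨2,2,2⟩` computes `Z = X·Y`; the output index of `⟨2,2,2⟩` is `(κ,ν)` for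
`Z_{κν}`, the inputs `(κ,μ)` for `X_{κμ}` and `(μ,ν)` for `Y_{μν}`.  Block `0`: `ac` (`X = a`, `Y = c`);
block `1`: `adj(d)b = (bᵀ adj(d)ᵀ)ᵀ` (`X = bᵀ`, `Y = adj(d)ᵀ`, output transposed, sign `−`);
block `2`: `da = (aᵀdᵀ)ᵀ`; block `3`: `b·adj(c)`.  `adj(E_{kl}) = (−1)^{k+l} E_{l̄ k̄}`, `x̄ = Fin.rev x`. -/

/-- Output table `tA (octEnc o) j κ ν = A o (j,(κ,ν))`: the coefficient with which the output
coordinate `Z_{κν}` of block `j` enters the octonion coordinate `o = (o₁; m, n)`; entries in `{0, ±1}`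
(block `0`: `Z_{mn} ↦ +1`; block `1`: `Z_{nm} ↦ −1`; blocks `2`, `3` (degree `1`): `Z_{nm}`, `Z_{mn} ↦ +1`). -/
local notation "tA" =>
  (![
    ![![![1, 0], ![0, 0]], ![![-1, 0], ![0, 0]], ![![0, 0], ![0, 0]], ![![0, 0], ![0, 0]]],
    ![![![0, 1], ![0, 0]], ![![0, 0], ![-1, 0]], ![![0, 0], ![0, 0]], ![![0, 0], ![0, 0]]],
    ![![![0, 0], ![1, 0]], ![![0, -1], ![0, 0]], ![![0, 0], ![0, 0]], ![![0, 0], ![0, 0]]],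
    ![![![0, 0], ![0, 1]], ![![0, 0], ![0, -1]], ![![0, 0], ![0, 0]], ![![0, 0], ![0, 0]]],
    ![![![0, 0], ![0, 0]], ![![0, 0], ![0, 0]], ![![1, 0], ![0, 0]], ![![1, 0], ![0, 0]]],
    ![![![0, 0], ![0, 0]], ![![0, 0], ![0, 0]], ![![0, 0], ![1, 0]], ![![0, 1], ![0, 0]]],
    ![![![0, 0], ![0, 0]], ![![0, 0], ![0, 0]], ![![0, 1], ![0, 0]], ![![0, 0], ![1, 0]]],
    ![![![0, 0], ![0, 0]], ![![0, 0], ![0, 0]], ![![0, 0], ![0, 1]], ![![0, 0], ![0, 1]]]] : Fin 8 → Fin 4 → Fin 2 → Fin 2 → ℤ)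

/-- First-input table `tB (octEnc p) j κ μ = B p (j,(κ,μ))`: the image of `p = (p₁; i, j)` in the
`X`-slot of block `j` (`a ↦ a` in blocks `0`, `3`; `a ↦ aᵀ` in blocks `1`, `2`); entries in `{0, 1}`. -/
local notation "tB" =>
  (![
    ![![![1, 0], ![0, 0]], ![![0, 0], ![0, 0]], ![![1, 0], ![0, 0]], ![![0, 0], ![0, 0]]],
    ![![![0, 1], ![0, 0]], ![![0, 0], ![0, 0]], ![![0, 0], ![1, 0]], ![![0, 0], ![0, 0]]],
    ![![![0, 0], ![1, 0]], ![![0, 0], ![0, 0]], ![![0, 1], ![0, 0]], ![![0, 0], ![0, 0]]],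
    ![![![0, 0], ![0, 1]], ![![0, 0], ![0, 0]], ![![0, 0], ![0, 1]], ![![0, 0], ![0, 0]]],
    ![![![0, 0], ![0, 0]], ![![1, 0], ![0, 0]], ![![0, 0], ![0, 0]], ![![1, 0], ![0, 0]]],
    ![![![0, 0], ![0, 0]], ![![0, 0], ![1, 0]], ![![0, 0], ![0, 0]], ![![0, 1], ![0, 0]]],
    ![![![0, 0], ![0, 0]], ![![0, 1], ![0, 0]], ![![0, 0], ![0, 0]], ![![0, 0], ![1, 0]]],
    ![![![0, 0], ![0, 0]], ![![0, 0], ![0, 1]], ![![0, 0], ![0, 0]], ![![0, 0], ![0, 1]]]] : Fin 8 → Fin 4 → Fin 2 → Fin 2 → ℤ)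

/-- Second-input table `tC (octEnc q) j μ ν = C q (j,(μ,ν))`: the image of `q = (q₁; k, l)` in the
`Y`-slot of block `j` (`c ↦ c`, `adj(c)ᵀ`, `cᵀ`, `adj(c)` in blocks `0, 1, 2, 3`); entries in `{0, ±1}`. -/
local notation "tC" =>
  (![
    ![![![1, 0], ![0, 0]], ![![0, 0], ![0, 0]], ![![0, 0], ![0, 0]], ![![0, 0], ![0, 1]]],
    ![![![0, 1], ![0, 0]], ![![0, 0], ![0, 0]], ![![0, 0], ![0, 0]], ![![0, -1], ![0, 0]]],
    ![![![0, 0], ![1, 0]], ![![0, 0], ![0, 0]], ![![0, 0], ![0, 0]], ![![0, 0], ![-1, 0]]],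
    ![![![0, 0], ![0, 1]], ![![0, 0], ![0, 0]], ![![0, 0], ![0, 0]], ![![1, 0], ![0, 0]]],
    ![![![0, 0], ![0, 0]], ![![0, 0], ![0, 1]], ![![1, 0], ![0, 0]], ![![0, 0], ![0, 0]]],
    ![![![0, 0], ![0, 0]], ![![0, 0], ![-1, 0]], ![![0, 0], ![1, 0]], ![![0, 0], ![0, 0]]],
    ![![![0, 0], ![0, 0]], ![![0, -1], ![0, 0]], ![![0, 1], ![0, 0]], ![![0, 0], ![0, 0]]],
    ![![![0, 0], ![0, 0]], ![![1, 0], ![0, 0]], ![![0, 0], ![0, 1]], ![![0, 0], ![0, 0]]]] : Fin 8 → Fin 4 → Fin 2 → Fin 2 → ℤ)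

/-! ## Bookkeeping: sums against `⟨t⟩ ⊗ s` and against `⟨k,m,n⟩` -/

/-- Summing against a multiple `⟨t⟩ ⊗ s` keeps only the block-diagonal terms:
`∑_{a,b,c} f a · g b · h c · (⟨t⟩ ⊗ s) a b c = ∑_j ∑_{x,y,z} f (j,x) · g (j,y) · h (j,z) · s x y z`.
[folklore] -/
theorem sum_kronecker_unitTensor {R α β γ : Type*} [CommSemiring R] [Fintype α] [Fintype β]
    [Fintype γ] {t : ℕ} (f : Fin t × α → R) (g : Fin t × β → R) (h : Fin t × γ → R)
    (s : α → β → γ → R) :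
    ∑ a : Fin t × α, ∑ b : Fin t × β, ∑ c : Fin t × γ,
        f a * g b * h c * kroneckerTensor (unitTensor R t) s a b c =
      ∑ j : Fin t, ∑ x : α, ∑ y : β, ∑ z : γ, f (j, x) * g (j, y) * h (j, z) * s x y z := by
  simp only [kroneckerTensor_apply, unitTensor_apply, Fintype.sum_prod_type, ite_and, ite_mul,
    one_mul, zero_mul, mul_ite, mul_zero, Finset.sum_ite_irrel, Finset.sum_const_zero,
    Finset.sum_ite_eq, Finset.mem_univ, if_true]

/-- Summing against `⟨k,m,n⟩` keeps only its support:
`∑_{x,y,z} F x · G y · H z · ⟨k,m,n⟩ x y z = ∑_{κ,μ,ν} F (κ,ν) · G (κ,μ) · H (μ,ν)`. [folklore] -/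
theorem sum_matMulTensor {R : Type*} [CommSemiring R] {k m n : ℕ} (F : Fin k × Fin n → R)
    (G : Fin k × Fin m → R) (H : Fin m × Fin n → R) :
    ∑ x : Fin k × Fin n, ∑ y : Fin k × Fin m, ∑ z : Fin m × Fin n,
        F x * G y * H z * matMulTensor R k m n x y z =
      ∑ κ : Fin k, ∑ μ : Fin m, ∑ ν : Fin n, F (κ, ν) * G (κ, μ) * H (μ, ν) := by
  simp only [matMulTensor, Fintype.sum_prod_type, ite_and, mul_ite, mul_one, mul_zero,
    Finset.sum_ite_irrel, Finset.sum_const_zero, Finset.sum_ite_eq, Finset.mem_univ, if_true]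
  exact Finset.sum_congr rfl fun κ _ => Finset.sum_comm

/-! ## The kernel certificate -/

set_option maxHeartbeats 4000000 in
/-- **Kernel certificate** (`512` integer identities of `32` terms, `decide +kernel`): the signed
table `octTab = octT ℤ` of the split octonions is the sum over the four blocks `j` and the support
`(κ,μ,ν)` of `⟨2,2,2⟩` of `A o (j,(κ,ν)) · B p (j,(κ,μ)) · C q (j,(μ,ν))`. [folklore] -/
theorem key4x8 : ∀ o p q : Fin 2 × Fin 2 × Fin 2,
    octTab o p q = ∑ j : Fin 4, ∑ κ : Fin 2, ∑ μ : Fin 2, ∑ ν : Fin 2,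
      tA (octEnc o) j κ ν * tB (octEnc p) j κ μ * tC (octEnc q) j μ ν := by
  decide +kernel

/-! ## `⟨4⟩ ⊗ ⟨2,2,2⟩ ≥ t₈` and the asymptotic-rank bound -/

/-- **`t₈` is a restriction of four `2 × 2` matrix products**: `⟨4⟩ ⊗ ⟨2,2,2⟩ ≥ octT ℂ`
(`TensorRestrictsTo`, CVZ §1.1), with the integer witnesses `tA`, `tB`, `tC` read in `ℂ`: the four
graded blocks `ac`, `−adj(d)b`, `da`, `b·adj(c)` of the Cayley–Dickson product `(a,b)(c,d)` are
`GL`-copies of `⟨2,2,2⟩` glued additively along the `ℤ/2`-grading. [folklore] -/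
theorem fourBlocks_restrictsTo_octT :
    TensorRestrictsTo (kroneckerTensor (unitTensor ℂ 4) (matMulTensor ℂ 2 2 2))
      (Summit.MatrixMultiplication.MatrixMultiplication.Theorems.OctonionicLaser.octT ℂ) := by
  refine ⟨fun o a => ((tA (octEnc o) a.1 a.2.1 a.2.2 : ℤ) : ℂ),
    fun p b => ((tB (octEnc p) b.1 b.2.1 b.2.2 : ℤ) : ℂ),
    fun q c => ((tC (octEnc q) c.1 c.2.1 c.2.2 : ℤ) : ℂ), fun o p q => ?_⟩
  rw [sum_kronecker_unitTensor]
  simp only [sum_matMulTensor]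
  rw [octT_complex_eq_octTab, key4x8 o p q]
  push_cast
  rfl

/-- **`R̃(t₈) ≤ 4 · 2^ω`**: the asymptotic rank of complex octonion multiplication is at most that of
four independent `2 × 2` matrix products, `R̃(⟨4⟩ ⊗ ⟨2,2,2⟩) = 4 · 2^ω`
(`asymptoticRank_multiple_matMulTensor_cube`), by monotonicity of `R̃` under restriction
(`asymptoticRank_le_of_polyDegeneratesTo`). [folklore] -/
theorem asymptoticRank_octT_le_four_mul_two_rpow_omega :
    asymptoticRank (octT ℂ) ≤ 4 * (2 : ℝ) ^ omega ℂ := by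
  have h := asymptoticRank_le_of_polyDegeneratesTo fourBlocks_restrictsTo_octT.polyDegeneratesTo
  rw [asymptoticRank_multiple_matMulTensor_cube ℂ (q := 2) (t := 4) (by norm_num) (by norm_num)] at h
  exact_mod_cast h

/-- Numerics: `2^{19/8} < 83/16` (because `2^51 < 83^8`). [folklore] -/
theorem two_rpow_nineteen_eighths_lt : (2 : ℝ) ^ ((19 : ℝ) / 8) < 83 / 16 := by
  have h8 : ((2 : ℝ) ^ ((19 : ℝ) / 8)) ^ (8 : ℕ) = 2 ^ (19 : ℕ) := by
    rw [← Real.rpow_natCast, ← Real.rpow_mul (by norm_num : (0 : ℝ) ≤ 2)]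
    norm_num
  have hlt : ((2 : ℝ) ^ ((19 : ℝ) / 8)) ^ (8 : ℕ) < (83 / 16 : ℝ) ^ (8 : ℕ) := by
    rw [h8]; norm_num
  exact lt_of_pow_lt_pow_left₀ 8 (by norm_num) hlt

/-- **`R̃(t₈) < 83/4 = 20.75`**: the four-block bound with the tree's proved `ω ≤ 2.37295`
(`LeGall2014_cw4_omega_le`) and `2^{2.37295} ≤ 2^{19/8} < 83/16`.  Previous best:
`R̃(t₈) ≤ R(t₈) ≤ 26` (`tensorRank_octT_leTwentySix`). [folklore] -/
theorem asymptoticRank_octT_lt : Literature.Computability.AlgebraicComplexity.asymptoticRank (Summit.MatrixMultiplication.MatrixMultiplication.Theorems.OctonionicLaser.octT ℂ) < 83 / 4 := by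
  have hω : omega ℂ ≤ 2.37295 := LeGall2014_cw4_omega_le ℂ
  have h1 : (2 : ℝ) ^ omega ℂ ≤ (2 : ℝ) ^ ((19 : ℝ) / 8) :=
    Real.rpow_le_rpow_of_exponent_le (by norm_num) (hω.trans (by norm_num))
  have h2 := two_rpow_nineteen_eighths_lt
  calc asymptoticRank (octT ℂ) ≤ 4 * (2 : ℝ) ^ omega ℂ := asymptoticRank_octT_le_four_mul_two_rpow_omega
    _ ≤ 4 * (2 : ℝ) ^ ((19 : ℝ) / 8) := by gcongr
    _ < 4 * (83 / 16) := by linarith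
    _ = 83 / 4 := by norm_num

/-- **The milestones at rate `83/4`** (the registered stub asks for rate `8`): for every `δ > 0` some
Kronecker power `𝕊^{⊠k}`, `k ≥ 1`, of the signed `𝔽₂³` octonion table has
`bR(𝕊^{⊠k}) ≤ ((83/4)(1+δ))^k` — by `R̃(𝕊) = R̃(t₈) < 83/4` (`asymptoticRank_signedTable_eq`) and
`milestones_of_asymptoticRank_le`. [folklore] -/
theorem signedTable_milestones_rate :
    ∀ δ : ℝ, 0 < δ → ∃ k : ℕ, 1 ≤ k ∧
      (algBorderRank (kroneckerPow (fun z x y : Fin 2 × Fin 2 × Fin 2 =>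
        if z = x + y then
          (if x.1 * y.1 + x.1 * y.2.1 + x.1 * y.2.2 + x.2.1 * y.2.1 + x.2.1 * y.2.2 + x.2.2 * y.2.2
                + y.1 * x.2.1 * x.2.2 + x.1 * y.2.1 * x.2.2 + x.1 * x.2.1 * y.2.2 = (1 : Fin 2)
            then (-1 : ℂ) else (1 : ℂ))
        else (0 : ℂ)) k) : ℝ) ≤ ((83 / 4 : ℝ) * (1 + δ)) ^ k :=
  milestones_of_asymptoticRank_le (by norm_num)
    (asymptoticRank_signedTable_eq ▸ asymptoticRank_octT_lt.le)

end OctAsymptoticRank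

end Summit.MatrixMultiplication.MatrixMultiplication.Theorems

end
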